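import Mathlib
import Summits.ValiantsHypothesis.ValiantsHypothesis.Theorems.NewtonFramesNewtonTauWeakBlockConvexFarey
import Summits.ValiantsHypothesis.ValiantsHypothesis.Theorems.NewtonFramesCappedSlopeSum

/-!
# Crux `NewtonTauWeak` (stmt-ValiantsHypothesis-5904), line `landing-collapse`: the rung `CappedSlopeSum` is SHARP
(exponent exactly `7/3`; kernel constant window `[1/8, 5]`)

The rung `stub_cappedSlopeSumRung : CappedSlopeSum` of `Cruxes/NewtonTauWeak/Lines/landing_collapse.lean` — for `≤ n²`
non-vertical real lines `y = s·x + c`, `(s, c) ∈ Λ`, the number of LANDINGS (pairs (slope, covered point of the grid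
`range n × range n`), capped at `n` per slope) is `≤ C (n+2)^{7/3}` — is LANDED with `C = 5`
(`Theorems/NewtonFramesCappedSlopeSum.lean`, `CappedSlopeSum.cappedSlopeSum_bound`, p601033).  Its docstring and the line
card call it "tight by `BlockConvexFarey.farey_parabola_main`"; that theorem, however, counts convex-position points of a
three-fold sumset, not capped landings, and the identification of the two counts lives only in prose.  This file puts
the lower side of the calibration in the kernel, for the rung's OWN quantity:

* `cappedSlopeSum_ge n R` — the FAREY LINE FAMILY `Λ = {(a/b, u/b) : 1 ≤ a ≤ b ≤ R, gcd(a,b) = 1, u < R}` has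
  `#Λ ≤ R³` and capped slope sum `≥ n · F(R) ≥ n R²/8` (`F(R)` = Farey count, `8 F(R) ≥ R²` is
  `BlockConvexFarey.eight_mul_fareyCount_ge`): every reduced slope `a/b ≤ 1` of height `≤ R` covers one grid point in
  EVERY column `i < n` (the line `y = (a i + u)/b` with `u ≡ -a i (mod b)`, `u < b ≤ R`), and distinct reduced fractions
  are distinct slopes (`BlockConvexFarey.coprime_frac_unique`);
* `cappedSlopeSum_ge_main m` — with `n = m³`, `R = m²`: `#Λ ≤ n²` and capped slope sum `≥ m⁷/8 = n^{7/3}/8`;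
* `cappedSlopeSum_exponent_ge` — consequently NO bound `C (n+2)^e` with `e < 7/3` holds, for any `C`;
* `cappedSlopeSum_const_ge` — and at the exponent `7/3` every admissible constant has `C ≥ 1/8`;
* `cappedSlopeSum_sharp` — packaging with the landed upper bound: the rung holds with `C = 5` (by name,
  `CappedSlopeSum.cappedSlopeSum_bound`) and `7/3` is the least exponent.

So the kernel window for the rung is: exponent EXACTLY `7/3`, optimal constant in `[1/8, 5]` (the card's numerics:
`≈ 0.30–0.35` for this family with the true Farey density `3/π²`, `≈ 1.42–1.44` for the greedy optimum).

Calibration helper for the crux item (`--supports`), no new definitions.  Nothing here bears on `ThreeSetBound` (the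
line's LAW), `BlockConvexBound`, the crux `NewtonTauWeak`, or `VP ≠ VNP`.
-/

set_option linter.dupNamespace false

namespace Summit.ValiantsHypothesis.ValiantsHypothesis.Theorems.NewtonFramesNewtonTauWeak.CappedSlopeSumSharp

open scoped BigOperators
open Summit.ValiantsHypothesis.ValiantsHypothesis.Theorems.NewtonFramesNewtonTauWeak.BlockConvexFarey
  (coprime_frac_unique dvd_add_residue eight_mul_fareyCount_ge)
open Summit.ValiantsHypothesis.ValiantsHypothesis.Theorems.NewtonFramesNewtonTauWeak.CappedSlopeSum
  (cappedSlopeSum_bound)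

noncomputable section

/-! ### 1. The Farey line family and its capped slope sum -/

open Classical in
/-- **Lower bound for the capped slope sum.**  For all `n, R` there is a set `Λ` of at most `R³` lines (the Farey
line family `{(a/b, u/b) : 1 ≤ a ≤ b ≤ R, gcd(a,b)=1, u < R}`) whose capped slope sum on the grid
`range n × range n` is at least `n R²/8`: each of the `F(R) ≥ R²/8` reduced slopes covers a grid point in every
column, so contributes exactly `n` after capping. [folklore] -/
theorem cappedSlopeSum_ge (n R : ℕ) :
    ∃ Λ : Finset (ℝ × ℝ), Λ.card ≤ R ^ 3 ∧
      (n : ℝ) * (R : ℝ) ^ 2 / 8 ≤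
        ∑ s ∈ Λ.image Prod.fst,
          (min n (((Finset.range n) ×ˢ (Finset.range n)).filter
            (fun x : ℕ × ℕ => ∃ l ∈ Λ, l.1 = s ∧ (x.2 : ℝ) = s * (x.1 : ℝ) + l.2)).card : ℝ) := by
  classical
  -- reduced fractions `a/b`, `1 ≤ a ≤ b ≤ R`
  set I : Finset (ℕ × ℕ) := ((Finset.Ioc 0 R) ×ˢ (Finset.Ioc 0 R)).filter
      fun p : ℕ × ℕ => p.1 ≤ p.2 ∧ Nat.Coprime p.1 p.2 with hI
  -- slope of `p = (a, b)` and the line `(a/b, u/b)`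
  set sl : ℕ × ℕ → ℝ := fun p => (p.1 : ℝ) / (p.2 : ℝ) with hsl
  set ln : (ℕ × ℕ) × ℕ → ℝ × ℝ := fun q => (sl q.1, (q.2 : ℝ) / (q.1.2 : ℝ)) with hln
  set Λ : Finset (ℝ × ℝ) := (I ×ˢ Finset.range R).image ln with hΛ
  refine ⟨Λ, ?_, ?_⟩
  · calc Λ.card ≤ (I ×ˢ Finset.range R).card := Finset.card_image_le
        _ = I.card * R := by rw [Finset.card_product, Finset.card_range]
        _ ≤ (R * R) * R := by
            gcongr
            calc I.card ≤ ((Finset.Ioc 0 R) ×ˢ (Finset.Ioc 0 R)).card := Finset.card_filter_le _ _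
              _ = R * R := by simp
        _ = R ^ 3 := by ring
  · -- the covered set of a slope
    set cov : ℝ → Finset (ℕ × ℕ) := fun s => ((Finset.range n) ×ˢ (Finset.range n)).filter
        (fun x : ℕ × ℕ => ∃ l ∈ Λ, l.1 = s ∧ (x.2 : ℝ) = s * (x.1 : ℝ) + l.2) with hcov
    -- membership in `I`, unpacked
    have hmemI : ∀ p ∈ I, (0 < p.1 ∧ p.1 ≤ R) ∧ (0 < p.2 ∧ p.2 ≤ R) ∧ p.1 ≤ p.2 ∧ Nat.Coprime p.1 p.2 := by
      intro p hp
      simp only [hI, Finset.mem_filter, Finset.mem_product, Finset.mem_Ioc] at hp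
      exact ⟨hp.1.1, hp.1.2, hp.2.1, hp.2.2⟩
    -- Step 1: every reduced slope `a/b ≤ 1` covers a point in each column `i < n`, hence `≥ n` points
    have hcol : ∀ p ∈ I, n ≤ (cov (sl p)).card := by
      intro p hp
      obtain ⟨⟨-, -⟩, ⟨hb0, hbR⟩, hab, -⟩ := hmemI p hp
      have hsurj : Set.SurjOn Prod.fst (cov (sl p) : Set (ℕ × ℕ)) (Finset.range n : Set ℕ) := by
        intro i hi
        rw [Finset.coe_range, Set.mem_Iio] at hi
        -- the residue `u ≡ -a i (mod b)` and the row `l = (a i + u)/b`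
        set u : ℕ := p.1 * i * (p.2 - 1) % p.2 with hu
        set l : ℕ := (p.1 * i + u) / p.2 with hl
        have hub : u < p.2 := Nat.mod_lt _ hb0
        have hdvd : p.2 ∣ p.1 * i + u := dvd_add_residue p.1 i p.2 hb0
        have hlb : l * p.2 = p.1 * i + u := Nat.div_mul_cancel hdvd
        have hlt : l < n := by
          have h1 : p.1 * i ≤ p.2 * i := Nat.mul_le_mul_right i hab
          have h2 : l * p.2 < n * p.2 := by
            rw [hlb]
            have : i + 1 ≤ n := hi
            nlinarith
          exact Nat.lt_of_mul_lt_mul_right h2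
        have hmemΛ : ln (p, u) ∈ Λ :=
          Finset.mem_image_of_mem _ (Finset.mem_product.2 ⟨hp, Finset.mem_range.2 (lt_of_lt_of_le hub hbR)⟩)
        have hbR' : (p.2 : ℝ) ≠ 0 := by exact_mod_cast hb0.ne'
        have hlR : (l : ℝ) * p.2 = p.1 * i + u := by exact_mod_cast hlb
        refine ⟨(i, l), ?_, rfl⟩
        rw [Finset.mem_coe, hcov]
        simp only [Finset.mem_filter, Finset.mem_product, Finset.mem_range]
        refine ⟨⟨hi, hlt⟩, ln (p, u), hmemΛ, rfl, ?_⟩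
        simp only [hln, hsl]
        rw [div_mul_eq_mul_div, ← add_div, eq_div_iff hbR']
        exact hlR
      calc n = (Finset.range n).card := (Finset.card_range n).symm
        _ ≤ (cov (sl p)).card := Finset.card_le_card_of_surjOn Prod.fst hsurj
    -- Step 2: distinct reduced fractions give distinct slopes, all of them slopes of `Λ`
    have hslinj : Set.InjOn sl I := by
      intro p hp q hq h
      obtain ⟨⟨-, -⟩, ⟨hb0, -⟩, -, hcop⟩ := hmemI p (Finset.mem_coe.1 hp)
      obtain ⟨⟨-, -⟩, ⟨hd0, -⟩, -, hcoq⟩ := hmemI q (Finset.mem_coe.1 hq)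
      have hb : (p.2 : ℝ) ≠ 0 := by exact_mod_cast hb0.ne'
      have hd : (q.2 : ℝ) ≠ 0 := by exact_mod_cast hd0.ne'
      simp only [hsl] at h
      rw [div_eq_div_iff hb hd] at h
      have hcrossN : p.1 * q.2 = q.1 * p.2 := by exact_mod_cast h
      obtain ⟨h1, h2⟩ := coprime_frac_unique hb0 hd0 hcop hcoq hcrossN
      exact Prod.ext h1 h2
    have himg : I.image sl ⊆ Λ.image Prod.fst := by
      intro s hs
      obtain ⟨p, hp, rfl⟩ := Finset.mem_image.1 hs
      obtain ⟨⟨-, -⟩, ⟨hb0, hbR⟩, -, -⟩ := hmemI p hp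
      exact Finset.mem_image.2 ⟨ln (p, 0), Finset.mem_image_of_mem _
        (Finset.mem_product.2 ⟨hp, Finset.mem_range.2 (lt_of_lt_of_le hb0 hbR)⟩), rfl⟩
    -- Step 3: sum it up
    have hF : (R : ℝ) ^ 2 ≤ 8 * (I.card : ℝ) := eight_mul_fareyCount_ge R
    have hn : (0 : ℝ) ≤ n := Nat.cast_nonneg _
    have hnF : (n : ℝ) * (R : ℝ) ^ 2 ≤ (n : ℝ) * (8 * (I.card : ℝ)) := mul_le_mul_of_nonneg_left hF hn
    show (n : ℝ) * (R : ℝ) ^ 2 / 8 ≤ ∑ s ∈ Λ.image Prod.fst, min (n : ℝ) (((cov s).card : ℕ) : ℝ)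
    calc (n : ℝ) * (R : ℝ) ^ 2 / 8 ≤ (n : ℝ) * I.card := by linarith
      _ = ∑ p ∈ I, (n : ℝ) := by rw [Finset.sum_const, nsmul_eq_mul, mul_comm]
      _ ≤ ∑ p ∈ I, min (n : ℝ) (((cov (sl p)).card : ℕ) : ℝ) :=
          Finset.sum_le_sum fun p hp => by rw [min_eq_left (by exact_mod_cast hcol p hp)]
      _ = ∑ s ∈ I.image sl, min (n : ℝ) (((cov s).card : ℕ) : ℝ) :=
          (Finset.sum_image (f := fun s => min (n : ℝ) (((cov s).card : ℕ) : ℝ)) hslinj).symm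
      _ ≤ ∑ s ∈ Λ.image Prod.fst, min (n : ℝ) (((cov s).card : ℕ) : ℝ) :=
          Finset.sum_le_sum_of_subset_of_nonneg himg fun _ _ _ =>
            le_min (Nat.cast_nonneg _) (Nat.cast_nonneg _)

open Classical in
/-- **`n^{7/3}/8` with `≤ n²` lines.**  With `n = m³`, `R = m²`: a line set of size `≤ m⁶ = n²` and capped slope sum
`≥ m⁷/8 = n^{7/3}/8` (against the landed upper bound `5 (n+2)^{7/3}`). [folklore] -/
theorem cappedSlopeSum_ge_main (m : ℕ) :
    ∃ Λ : Finset (ℝ × ℝ), Λ.card ≤ (m ^ 3) ^ 2 ∧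
      ((m : ℝ) ^ 7) / 8 ≤
        ∑ s ∈ Λ.image Prod.fst,
          (min (m ^ 3) (((Finset.range (m ^ 3)) ×ˢ (Finset.range (m ^ 3))).filter
            (fun x : ℕ × ℕ => ∃ l ∈ Λ, l.1 = s ∧ (x.2 : ℝ) = s * (x.1 : ℝ) + l.2)).card : ℝ) := by
  obtain ⟨Λ, hcard, hge⟩ := cappedSlopeSum_ge (m ^ 3) (m ^ 2)
  push_cast at hge
  refine ⟨Λ, hcard.trans (le_of_eq (by ring)), le_trans (le_of_eq (by ring)) hge⟩

/-! ### 2. Consequences: the exponent `7/3` and the constant `1/8` cannot be lowered -/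

open Classical in
/-- **No exponent below `7/3`.**  If `C (n+2)^e` bounds the capped slope sum of every `Λ` with `#Λ ≤ n²`, then
`e ≥ 7/3`: otherwise `m⁷/8 ≤ C (m³+2)^e ≤ C 3^e m^{3e}` (for `e ≥ 0`, `m ≥ 1`) forces `m^{7-3e}` bounded. [folklore] -/
theorem cappedSlopeSum_exponent_ge (C e : ℝ)
    (h : ∀ (n : ℕ) (Λ : Finset (ℝ × ℝ)), Λ.card ≤ n ^ 2 →
      (∑ s ∈ Λ.image Prod.fst,
          (min n (((Finset.range n) ×ˢ (Finset.range n)).filter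
            (fun x : ℕ × ℕ => ∃ l ∈ Λ, l.1 = s ∧ (x.2 : ℝ) = s * (x.1 : ℝ) + l.2)).card : ℝ)) ≤
        C * ((n : ℝ) + 2) ^ e) :
    (7 : ℝ) / 3 ≤ e := by
  by_contra hlt
  rw [not_le] at hlt
  -- the benchmark inequality
  have hmain : ∀ m : ℕ, ((m : ℝ) ^ 7) / 8 ≤ C * ((m : ℝ) ^ 3 + 2) ^ e := by
    intro m
    obtain ⟨Λ, hcard, hge⟩ := cappedSlopeSum_ge_main m
    have := h (m ^ 3) Λ hcard
    push_cast at this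
    exact hge.trans this
  -- `C ≥ 0`
  have hC : 0 ≤ C := by
    have h0 := hmain 0
    norm_num at h0
    have h2 : (0 : ℝ) < (2 : ℝ) ^ e := Real.rpow_pos_of_pos (by norm_num) e
    by_contra hC
    rw [not_le] at hC
    have : C * (2 : ℝ) ^ e < 0 := mul_neg_of_neg_of_pos hC h2
    linarith
  -- replace `e` by `e' = max e 0 ∈ [0, 7/3)`
  set e' : ℝ := max e 0 with he'
  have he'lt : e' < 7 / 3 := max_lt hlt (by norm_num)
  have he'0 : 0 ≤ e' := le_max_right _ _
  have hbound : ∀ m : ℕ, 1 ≤ m → ((m : ℝ) ^ 7) / 8 ≤ C * (3 : ℝ) ^ e' * (m : ℝ) ^ (3 * e') := by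
    intro m hm
    have hm1 : (1 : ℝ) ≤ m := by exact_mod_cast hm
    have hm0 : (0 : ℝ) ≤ m := by positivity
    have hm31 : (1 : ℝ) ≤ (m : ℝ) ^ 3 := one_le_pow₀ hm1
    have hbase1 : (1 : ℝ) ≤ (m : ℝ) ^ 3 + 2 := by linarith
    have h1 : ((m : ℝ) ^ 3 + 2) ^ e ≤ ((m : ℝ) ^ 3 + 2) ^ e' :=
      Real.rpow_le_rpow_of_exponent_le hbase1 (le_max_left _ _)
    have h2 : ((m : ℝ) ^ 3 + 2) ^ e' ≤ (3 * (m : ℝ) ^ 3) ^ e' :=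
      Real.rpow_le_rpow (by positivity) (by linarith) he'0
    have hm3 : (m : ℝ) ^ (3 : ℝ) = (m : ℝ) ^ 3 := by exact_mod_cast Real.rpow_natCast (m : ℝ) 3
    have h3 : (3 * (m : ℝ) ^ 3) ^ e' = (3 : ℝ) ^ e' * (m : ℝ) ^ (3 * e') := by
      rw [Real.mul_rpow (by norm_num) (by positivity), Real.rpow_mul hm0, hm3]
    calc ((m : ℝ) ^ 7) / 8 ≤ C * ((m : ℝ) ^ 3 + 2) ^ e := hmain m
      _ ≤ C * ((3 : ℝ) ^ e' * (m : ℝ) ^ (3 * e')) := by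
          have := (h1.trans h2).trans (le_of_eq h3)
          exact mul_le_mul_of_nonneg_left this hC
      _ = C * (3 : ℝ) ^ e' * (m : ℝ) ^ (3 * e') := by ring
  -- divide by `m^{3e'}`
  set δ : ℝ := 7 - 3 * e' with hδ
  have hδpos : 0 < δ := by rw [hδ]; linarith
  set K : ℝ := 8 * C * (3 : ℝ) ^ e' with hK
  have hle : ∀ m : ℕ, 1 ≤ m → (m : ℝ) ^ δ ≤ K := by
    intro m hm
    have hm0 : (0 : ℝ) < m := by exact_mod_cast hm
    have hm7 : (m : ℝ) ^ (7 : ℝ) = (m : ℝ) ^ 7 := by exact_mod_cast Real.rpow_natCast (m : ℝ) 7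
    have hsplit : (m : ℝ) ^ 7 = (m : ℝ) ^ δ * (m : ℝ) ^ (3 * e') := by
      rw [← Real.rpow_add hm0, ← hm7]
      congr 1
      rw [hδ]
      ring
    have hpos : (0 : ℝ) < (m : ℝ) ^ (3 * e') := Real.rpow_pos_of_pos hm0 _
    have hb := hbound m hm
    rw [hsplit] at hb
    have hb' : (m : ℝ) ^ δ * (m : ℝ) ^ (3 * e') ≤ K * (m : ℝ) ^ (3 * e') := by
      rw [hK]; linarith
    exact le_of_mul_le_mul_right hb' hpos
  -- but `m^δ → ∞`
  have htend : Filter.Tendsto (fun m : ℕ => ((m : ℝ)) ^ δ) Filter.atTop Filter.atTop :=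
    (tendsto_rpow_atTop hδpos).comp tendsto_natCast_atTop_atTop
  obtain ⟨m, hmK, hm1⟩ := ((htend.eventually_gt_atTop K).and (Filter.eventually_ge_atTop 1)).exists
  exact absurd (hle m hm1) (not_le.mpr hmK)

open Classical in
/-- **No constant below `1/8` at the exponent `7/3`.**  If `C (n+2)^{7/3}` bounds the capped slope sum of every `Λ`
with `#Λ ≤ n²`, then `C ≥ 1/8`: `m⁷/8 ≤ C (m³+2)^{7/3}` means `(1/8)·(m³/(m³+2))^{7/3} ≤ C`, and the left side
tends to `1/8`. [folklore] -/
theorem cappedSlopeSum_const_ge (C : ℝ)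
    (h : ∀ (n : ℕ) (Λ : Finset (ℝ × ℝ)), Λ.card ≤ n ^ 2 →
      (∑ s ∈ Λ.image Prod.fst,
          (min n (((Finset.range n) ×ˢ (Finset.range n)).filter
            (fun x : ℕ × ℕ => ∃ l ∈ Λ, l.1 = s ∧ (x.2 : ℝ) = s * (x.1 : ℝ) + l.2)).card : ℝ)) ≤
        C * ((n : ℝ) + 2) ^ ((7 : ℝ) / 3)) :
    (1 : ℝ) / 8 ≤ C := by
  -- the benchmark inequality, rewritten as `(1/8) r_m^{7/3} ≤ C` with `r_m = m³/(m³+2)`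
  have hmain : ∀ m : ℕ, (1 : ℝ) / 8 * ((m : ℝ) ^ 3 / ((m : ℝ) ^ 3 + 2)) ^ ((7 : ℝ) / 3) ≤ C := by
    intro m
    obtain ⟨Λ, hcard, hge⟩ := cappedSlopeSum_ge_main m
    have hb := h (m ^ 3) Λ hcard
    push_cast at hb
    have hineq : ((m : ℝ) ^ 7) / 8 ≤ C * ((m : ℝ) ^ 3 + 2) ^ ((7 : ℝ) / 3) := hge.trans hb
    have hm0 : (0 : ℝ) ≤ (m : ℝ) ^ 3 := by positivity
    have hden : (0 : ℝ) < ((m : ℝ) ^ 3 + 2) ^ ((7 : ℝ) / 3) := Real.rpow_pos_of_pos (by positivity) _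
    have hm3 : (m : ℝ) ^ (3 : ℝ) = (m : ℝ) ^ 3 := by exact_mod_cast Real.rpow_natCast (m : ℝ) 3
    have hm7 : (m : ℝ) ^ (7 : ℝ) = (m : ℝ) ^ 7 := by exact_mod_cast Real.rpow_natCast (m : ℝ) 7
    have hnum : ((m : ℝ) ^ 3) ^ ((7 : ℝ) / 3) = (m : ℝ) ^ 7 := by
      rw [← hm3, ← hm7, ← Real.rpow_mul (Nat.cast_nonneg _)]
      norm_num
    rw [Real.div_rpow hm0 (by positivity), hnum]
    have hrew : (1 : ℝ) / 8 * ((m : ℝ) ^ 7 / ((m : ℝ) ^ 3 + 2) ^ ((7 : ℝ) / 3)) =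
        ((m : ℝ) ^ 7 / 8) / ((m : ℝ) ^ 3 + 2) ^ ((7 : ℝ) / 3) := by ring
    rw [hrew, div_le_iff₀ hden]
    exact hineq
  -- `r_m → 1`
  have hr : Filter.Tendsto (fun m : ℕ => (m : ℝ) ^ 3 / ((m : ℝ) ^ 3 + 2)) Filter.atTop (nhds 1) := by
    have h3 : Filter.Tendsto (fun m : ℕ => (m : ℝ) ^ 3 + 2) Filter.atTop Filter.atTop :=
      Filter.tendsto_atTop_add_const_right _ _
        ((Filter.tendsto_pow_atTop (by norm_num : (3 : ℕ) ≠ 0)).comp tendsto_natCast_atTop_atTop)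
    have h2 : Filter.Tendsto (fun m : ℕ => (2 : ℝ) / ((m : ℝ) ^ 3 + 2)) Filter.atTop (nhds 0) :=
      tendsto_const_nhds.div_atTop h3
    have heq : (fun m : ℕ => (m : ℝ) ^ 3 / ((m : ℝ) ^ 3 + 2)) = fun m : ℕ => 1 - 2 / ((m : ℝ) ^ 3 + 2) := by
      funext m
      have hD : (0 : ℝ) < (m : ℝ) ^ 3 + 2 := by positivity
      rw [eq_sub_iff_add_eq, ← add_div, div_self hD.ne']
    rw [heq]
    simpa using tendsto_const_nhds.sub h2
  have hlim : Filter.Tendsto (fun m : ℕ => (1 : ℝ) / 8 * ((m : ℝ) ^ 3 / ((m : ℝ) ^ 3 + 2)) ^ ((7 : ℝ) / 3))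
      Filter.atTop (nhds ((1 : ℝ) / 8)) := by
    have := (hr.rpow_const (Or.inr (by norm_num : (0 : ℝ) ≤ 7 / 3))).const_mul ((1 : ℝ) / 8)
    simpa using this
  exact le_of_tendsto' hlim fun m => hmain m

/-! ### 3. Packaging with the landed rung -/

open Classical in
/-- **The rung `CappedSlopeSum` is sharp.**  (i) It holds with `C = 5` (the LANDED `CappedSlopeSum.cappedSlopeSum_bound`,
p601033, by name); (ii) `7/3` is the least exponent `e` for which some `C (n+2)^e` bounds the capped slope sum of all
`Λ` with `#Λ ≤ n²`; (iii) at `e = 7/3` every admissible `C` is `≥ 1/8`. [folklore] -/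
theorem cappedSlopeSum_sharp :
    (∀ (n : ℕ) (Λ : Finset (ℝ × ℝ)), Λ.card ≤ n ^ 2 →
      (∑ s ∈ Λ.image Prod.fst,
          (min n (((Finset.range n) ×ˢ (Finset.range n)).filter
            (fun x : ℕ × ℕ => ∃ l ∈ Λ, l.1 = s ∧ (x.2 : ℝ) = s * (x.1 : ℝ) + l.2)).card : ℝ)) ≤
        5 * ((n : ℝ) + 2) ^ ((7 : ℝ) / 3)) ∧
    (∀ C e : ℝ, (∀ (n : ℕ) (Λ : Finset (ℝ × ℝ)), Λ.card ≤ n ^ 2 →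
      (∑ s ∈ Λ.image Prod.fst,
          (min n (((Finset.range n) ×ˢ (Finset.range n)).filter
            (fun x : ℕ × ℕ => ∃ l ∈ Λ, l.1 = s ∧ (x.2 : ℝ) = s * (x.1 : ℝ) + l.2)).card : ℝ)) ≤
        C * ((n : ℝ) + 2) ^ e) → (7 : ℝ) / 3 ≤ e) ∧
    (∀ C : ℝ, (∀ (n : ℕ) (Λ : Finset (ℝ × ℝ)), Λ.card ≤ n ^ 2 →
      (∑ s ∈ Λ.image Prod.fst,
          (min n (((Finset.range n) ×ˢ (Finset.range n)).filter
            (fun x : ℕ × ℕ => ∃ l ∈ Λ, l.1 = s ∧ (x.2 : ℝ) = s * (x.1 : ℝ) + l.2)).card : ℝ)) ≤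
        C * ((n : ℝ) + 2) ^ ((7 : ℝ) / 3)) → (1 : ℝ) / 8 ≤ C) :=
  ⟨cappedSlopeSum_bound, cappedSlopeSum_exponent_ge, cappedSlopeSum_const_ge⟩

end

end Summit.ValiantsHypothesis.ValiantsHypothesis.Theorems.NewtonFramesNewtonTauWeak.CappedSlopeSumSharp
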